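/-
COR-CM (cells pub-hodgecm / pub-hodgecm2, stage 2 of the Hodge ladder) — TEAM hCMisogE (coordinator ruling «FINISH AS FAST AS
POSSIBLE» 2026-08-21T18:44:30Z (1); pin-2 BRIEF `HOME/pinning/hcmisog/BRIEF.md` §1 sub-object (I2); pin-2 WORD «b01: take
(I2)+(G)» HOME/INBOX 2026-08-21T19:02:09Z; writer b01 = prover-pub-hodgecm2-b01-g79-0, acting hcmisog-isog-2).  The
DETERMINANT SKELETON of the identification `hCMisogE` (pin-2's `hCMisog`, `Transposition/Item6PinMatch.lean`:352, at the
`E`-rational pin `A_μ ⊗_{E,ι₁} ℂ := (Aμ₀ …).baseChange ℂ` of pin-3's assembly): `hCMisogE` FOLLOWS from four primitive inputs —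
Liu's rational CM structure `i_μ` read on the complex pin, [Liu 2021] Def. 4.5 (2) FIRST BULLET on an `E`-valued invariant `δ`
(«determinant on `Lie_E(A_μ)`»), the identity `ι₁ ∘ η_μ =` type norm of `Ψ̃_μ`, and the comparison «`δ` computes the
determinant on `H^{1,0}` of the base change» — by binder-1's `exists_isogeny_isCMTypeRealisation_of_det_complexAction`
(`Literature/AlgebraicGeometry/ComplexMultiplication/CMTypeOfHodgeDeterminant.lean`, p299960).  Theorems only: no definition, no
instance, no named fact, nothing asserted, no proof holes.  Imports landed tree modules only.  FRAMING: HC_CM is NOT proved.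
-/
import Literature.AlgebraicGeometry.ComplexMultiplication.CMTypeOfHodgeDeterminant
import Literature.AlgebraicGeometry.HodgeTheory.JacobianHodgeGenus
import Literature.AlgebraicGeometry.Motives.AbelianVarietyBaseChange
import Summits.HodgeConjecture.CorCM.B01.Transposition.Item6PinMatch
import HarnessLib

/-!
# Item (vi) S2, CM side: `hCMisogE` from a determinant identity (TEAM hCMisogE, sub-object (I2) — the composition skeleton)

The binder `hCMisogE` of pin-3's END display `Model.hc_cm_of_thm418AsPrinted_pinnedE_isog`
(`Transposition/Item6SupplyPinnedAssembly.lean`; = pin-2's `hCMisog`, `Transposition/Item6PinMatch.lean`:352, AT THE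
`E`-RATIONAL PIN `Aμ F ι₁ V Φ D_μ := (Aμ₀ F ι₁ V Φ D_μ).baseChange ℂ` along `ι₁.toAlgebra`) says: for Liu's value field
`M_μ = muAlgValueField F μ` ([Liu2021] §4.1 l. 1928) and the inclusion `e_μ : K* → M_μ` (Def. 4.3 (2) l. 1919), the complex
abelian variety `A_μ ⊗_{E,ι₁} ℂ` is ISOGENOUS to an `𝓞_{M_μ}`-realisation ON `H¹` of the induced type
`Ψ̃_μ = inducedCMType e_μ (reflexCMType ι₁ Φ_μ id)`.  By [Liu2021] Def. 4.5 (2) (l. 1944–1951) this is the content of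
«`i_μ : M_μ → End_E(A_μ)_ℚ` is a CM structure such that for every `x ∈ M_μ`, the determinant of the action of `i_μ(x)` on the
`E`-vector space `Lie_E(A_μ)` equals `η_μ(x)`» once (a) `ι₁ ∘ η_μ` is the type norm of `Ψ̃_μ` and (b) the determinant on
`Lie_E(A_μ)` (equivalently on its dual, the cotangent space at the origin), read in `ℂ` through `ι₁`, is the determinant on
`H^{1,0}(A_μ ⊗_{E,ι₁} ℂ) ⊂ H¹_B` (Hodge decomposition / invariant differentials: Shimura 1998 §2.8, §3.2; Lange–Birkenhake
Thm. 1.1.21, Prop. 1.1.23).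

THIS FILE proves that implication with (a), (b) and the first bullet as EXPLICIT HYPOTHESES on abstract data — an `E`-valued
invariant `δ : End A_μ → E` of `E`-rational endomorphisms (intended: `f ↦ det (T_e^*(f))`, TEAM sub-objects (L1)/(I1)) and a
function `η : M_μ → E` (intended: Liu's `η_μ = N_{Ψ_μ} ∘ Nm_{M_μ/M'_μ}`, sub-objects (I1)/(N)) — so that the three TEAM
supplies plug in BY NAME without this file changing:

* §1 `Model.exists_isogeny_isCMTypeRealisation_baseChange_of_detInvariant` — ONE abelian variety `A/E` with `Algebra E ℂ`, a number
  field `K` with `[K:ℚ] = 2 dim A`, a complex action `φ : K → End⁰(A ⊗_E ℂ)`, a CM type `Ψ` of `K`: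
  IF every `k ≠ 0` acts as `φ k = n⁻¹ · (f ⊗_E ℂ)` for an `E`-RATIONAL endomorphism `f` with `δ f = n^{dim A} · η k`
  (Def. 4.5 (2) first bullet, cleared of denominators), `ι(η k) = ∏_{θ ∈ Ψ} θ k`, and
  `det ((f ⊗_E ℂ)^* | H^{1,0}) = ι(δ f)` for all `f`, THEN `A ⊗_E ℂ` is isogenous to an `𝓞_K`-realisation of `Ψ` on `H¹`.
  Kernel: `complexAction φ k = n⁻¹ · (f ⊗_E ℂ)^*` on `H¹(A(ℂ); ℂ)` (`complexAction_βA`, `hOneAlgHom_apply`, `bettiRep_of`,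
  `complexBetti_map_ofRatClassBaseChangeEquiv`), `det (c · T) = c^{h^{1,0}} det T` with `h^{1,0} = dim A`
  (`AbelianVariety.finrank_hodgeOneZero_eq_dim`, `dim_baseChange`), and binder-1's composite.
* §2 `Model.hCMisogE_of_det` — the FACE-GUARDED FAMILY form: EXACTLY the type of the binder `hCMisogE` (verbatim from
  `Item6PinMatch.lean`:352 with `Aμ := (Aμ₀ …).baseChange ℂ`), from family versions of the same hypotheses (`iμ`, `δ`, `η`,
  `hdim`, `hrat`, `hη`, `hL2`), each guarded `IsGalois ℚ F → 6 ≤ [F:ℚ] → ι₁ ∈ Φ` (lead RULING «AS-PRINTED JUNCTION T1»).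

READING / STRENGTH.  Nothing is discharged here: `hCMisogE` ⟸ {`hrat` (Def. 4.5 (2) first bullet on `δ`, DATA of Liu's
object `D_μ` once `Obj := CMDatum` — sub-object (I1)), `hη` (a THEOREM of CM types — sub-objects (I1)/(N)), `hL2` (the
Hodge comparison — sub-object (L2), a cited standard theorem)}.  The consumer (pin-3 / hcmisog-glue) either keeps `hCMisogE`
and instantiates it with `Model.hCMisogE_of_det …`, or displays the three primitive binders instead.  No degree- or
face-specific input; NO printed hypothesis of [Liu2021] Thm. 4.18 is touched.  NOT claimed: that `hrat`/`hη`/`hL2` are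
inhabited here; that Liu's `A_μ` is constructed; that HC_CM is proved.

References: Y. Liu, *Fourier–Jacobi cycles and arithmetic relative trace formula*, Camb. J. Math. 9 (2021) = arXiv:2102.11518
(`FJcycle.tex` md5 6db49a74122d): §4.1 l. 1928, Def. 4.3 (2) l. 1919, Def. 4.5 l. 1936–1964; G. Shimura, *Abelian Varieties with
Complex Multiplication and Modular Functions* (1998) §2.8 (representation by invariant differential forms), §3.2 (analytic
and rational representations, `M ∼ S ⊕ S̄`), §5.2, §7.1 Prop. 7; H. Lange, Ch. Birkenhake, *Complex Abelian Varieties*, Thm. 1.1.21,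
Prop. 1.1.23.
-/

noncomputable section

open scoped TensorProduct

namespace Summit.HodgeConjecture.CorCM.Model

open CategoryTheory NumberField
open Literature.AlgebraicGeometry.Motives
open Literature.AlgebraicGeometry.HodgeTheory
open Literature.AlgebraicGeometry.ComplexMultiplication
open Literature.NumberTheory.ComplexMultiplication
open Literature.NumberTheory.Automorphic
open Literature.NumberTheory.Automorphic.IdeleClassGroup
open Literature.NumberTheory.Automorphic.PicardCM
open Literature.NumberTheory.Automorphic.Liu2021

/-! ## §1  One abelian variety: the CM type of `A ⊗_E ℂ` from a determinant identity on an `E`-valued invariant -/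

section Core

variable {E : Type} [Field E] [Algebra E ℂ] {K : Type} [Field K] [NumberField K]

/-- **Scalar pull-backs on `H¹(A(ℂ); ℂ)`**: if `φ k = n⁻¹ · (1 ⊗ g)` in `End⁰(A)` (`A/ℂ`, `g ∈ End A`), then
`complexAction φ k = n⁻¹ · g^*` on `H¹(A(ℂ); ℂ)` (`β` intertwines `g^* ⊗ ℂ` and `g^*`). [cite: Shimura1998, §3.2 and §5.2] -/
theorem complexAction_eq_smul_map_of_eq {A : AbelianVariety ℂ} (φ : K →+* A.endAlgebra) (k : K) (q : ℚ)
    (g : End A) (hφ : φ k = algebraMap ℚ A.endAlgebra q * AbelianVariety.endAlgebra.of A g)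
    (v : complexBetti A.X 1) :
    complexAction φ k v = (q : ℂ) • (complexBetti.map g.hom.hom.hom 1).hom v := by
  have h1 : hOneAlgHom φ k = q • BettiUniverse.pull g.hom.hom.hom 1 := by
    rw [hOneAlgHom_apply, hφ, map_mul, AlgHom.commutes, bettiRep_of, Algebra.algebraMap_eq_smul_one,
      smul_mul_assoc, one_mul, MulOpposite.unop_smul, MulOpposite.unop_op]
  obtain ⟨x, rfl⟩ := (βA A).surjective v
  rw [complexAction_βA, h1, LinearMap.baseChange_smul, LinearMap.smul_apply, ← algebraMap_smul ℂ q,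
    map_smul, eq_ratCast]
  congr 1
  exact (complexBetti_map_ofRatClassBaseChangeEquiv AbelianVariety.isSmoothProjective_holds
    AbelianVariety.isSmoothProjective_holds g.hom.hom.hom x).symm

/-- **Restriction of a scalar multiple**: if `T = c · S` on the ambient space and both preserve `W`, then
`T|_W = c · S|_W`. [folklore] -/
theorem restrict_eq_smul_restrict {V : Type*} [AddCommGroup V] [Module ℂ V] {W : Submodule ℂ V}
    {T S : V →ₗ[ℂ] V} (c : ℂ) (h : ∀ v, T v = c • S v) (hT : ∀ v ∈ W, T v ∈ W) (hS : ∀ v ∈ W, S v ∈ W) :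
    T.restrict hT = c • S.restrict hS := by
  refine LinearMap.ext fun w => Subtype.ext ?_
  rw [LinearMap.restrict_apply, LinearMap.smul_apply, Submodule.coe_smul, LinearMap.restrict_apply]
  exact h w

/-- **The CM type of a base change from a determinant identity — one abelian variety.**  `A/E` an abelian variety,
`Algebra E ℂ` (the embedding `ι = algebraMap E ℂ`), `K` a number field with `[K:ℚ] = 2 dim A`, `φ : K → End⁰(A ⊗_E ℂ)` a
ring homomorphism, `Ψ` a CM type of `K`, `δ : End A → E` and `η : K → E` functions.  IF
* `hrat` — every `k ≠ 0` acts through an `E`-RATIONAL endomorphism: `φ k = n⁻¹ · (1 ⊗ (f ⊗_E ℂ))`, `n ≥ 1`, `f ∈ End_E(A)`, with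
  `δ f = n^{dim A} · η k` ([Liu2021] Def. 4.5 (2) first bullet «the determinant of the action of `i_μ(x)` on the `E`-vector
  space `Lie_E(A_μ)` equals `η_μ(x)`», cleared of denominators);
* `hη` — `ι(η k) = ∏_{θ ∈ Ψ} θ(k)` (the type norm of `Ψ`);
* `hL2` — `det ((f ⊗_E ℂ)^* |_{H^{1,0}(A ⊗_E ℂ)}) = ι(δ f)` for every `f ∈ End_E(A)` (Hodge comparison, `H^{1,0}` =
  `hodgeOneZero`),
THEN `A ⊗_E ℂ` is ISOGENOUS to a complex abelian variety `B` with `ιB : 𝓞_K → End B`, `θB` realising `Ψ` on `H¹`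
(`IsCMTypeRealisation Ψ B ιB θB`) — binder-1's `exists_isogeny_isCMTypeRealisation_of_det_complexAction` (Shimura §5.2, §7.1
Prop. 7) at `W := H^{1,0}`, after `det ((complexAction φ k)|_{H^{1,0}}) = n^{-dim A} · ι(δ f) = ι(η k)`.
[cite: Liu2021, Def. 4.5 (2) (FJcycle.tex l. 1944–1951)] [cite: Shimura1998, §3.2, §5.2 (pp. 36–37) and §7.1 Prop. 7 (p. 47)] -/
theorem exists_isogeny_isCMTypeRealisation_baseChange_of_detInvariant (A : AbelianVariety E)
    (φ : K →+* (A.baseChange ℂ).endAlgebra) (hK : Module.finrank ℚ K = 2 * A.dim) (Ψ : CMType K)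
    (δ : End A → E) (η : K → E)
    (hrat : ∀ k : K, k ≠ 0 → ∃ (n : ℕ) (f : End A), n ≠ 0 ∧
      φ k = algebraMap ℚ (A.baseChange ℂ).endAlgebra ((n : ℚ)⁻¹) *
        AbelianVariety.endAlgebra.of (A.baseChange ℂ) (AbelianVariety.Hom.baseChange ℂ f) ∧
      δ f = (n : E) ^ A.dim * η k)
    (hη : ∀ k : K, k ≠ 0 → algebraMap E ℂ (η k) = ∏ᶠ θ ∈ Ψ.1, θ k)
    (hL2 : ∀ f : End A,
      LinearMap.det ((complexBetti.map (AbelianVariety.Hom.baseChange ℂ f).hom.hom.hom 1).hom.restrict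
        (fun _ hv => map_mem_hodgeOneZero (AbelianVariety.isSmoothProjective_holds (A := A.baseChange ℂ))
          (AbelianVariety.Hom.baseChange ℂ f).hom.hom.hom hv)) = algebraMap E ℂ (δ f)) :
    ∃ (B : AbelianVariety ℂ) (g : A.baseChange ℂ ⟶ B), AbelianVariety.IsIsogeny g ∧
      ∃ (ιB : 𝓞 K →+* End B) (θB : K →+* Module.End ℂ (complexBetti B.X 1)), IsCMTypeRealisation Ψ B ιB θB := by
  have hXℂ := AbelianVariety.isSmoothProjective_holds (A := A.baseChange ℂ)
  have hW : ∀ v, v ∈ hodgeOneZero hXℂ ↔ IsOfHodgeType (A.baseChange ℂ).dim (A.baseChange ℂ).X 1 1 0 v :=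
    fun _ => Iff.rfl
  have hst : ∀ k : K, ∀ v ∈ hodgeOneZero hXℂ, complexAction φ k v ∈ hodgeOneZero hXℂ :=
    fun k _ hv => complexAction_mem_of_mem_iff exists_isReal_hodgeModel_holds hodgePQ_independent_of_hodgeModel_holds
      φ _ hW k hv
  have hKℂ : Module.finrank ℚ K = 2 * (A.baseChange ℂ).dim := by
    rw [AbelianVariety.dim_baseChange]; exact hK
  refine exists_isogeny_isCMTypeRealisation_of_det_complexAction exists_isReal_hodgeModel_holds
    hodgePQ_independent_of_hodgeModel_holds φ hKℂ Ψ (hodgeOneZero hXℂ) hW hst fun k hk => ?_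
  obtain ⟨n, f, hn, hφ, hδ⟩ := hrat k hk
  have hact := complexAction_eq_smul_map_of_eq φ k ((n : ℚ)⁻¹) (AbelianVariety.Hom.baseChange ℂ f) hφ
  rw [restrict_eq_smul_restrict (((n : ℚ)⁻¹ : ℚ) : ℂ) hact (hst k)
    (fun _ hv => map_mem_hodgeOneZero hXℂ (AbelianVariety.Hom.baseChange ℂ f).hom.hom.hom hv),
    LinearMap.det_smul, hL2 f, hδ, map_mul, map_pow, map_natCast, hη k hk,
    AbelianVariety.finrank_hodgeOneZero_eq_dim (A.baseChange ℂ) hXℂ, AbelianVariety.dim_baseChange]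
  have hn' : (n : ℂ) ≠ 0 := Nat.cast_ne_zero.2 hn
  rw [Rat.cast_inv, Rat.cast_natCast, inv_pow, ← mul_assoc, inv_mul_cancel₀ (pow_ne_zero _ hn'), one_mul]

end Core

/-! ## §2  The face-guarded family: EXACTLY the binder `hCMisogE` -/

section Family

/-- **`hCMisogE` from the determinant skeleton** — the face-guarded family form, with EXACTLY the type of the binder
`hCMisogE` of `Model.hc_cm_of_thm418AsPrinted_pinnedE_isog` / `Model.faceSupply_of_thm418AsPrinted_pinnedE_isog` (= pin-2's
`hCMisog`, `Item6PinMatch.lean`:352, at the `E`-rational pin `(Aμ₀ F ι₁ V Φ D_μ).baseChange ℂ` along `ι₁`).  Carriers: `D`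
(Thm. 4.18 data), `Aμ₀` (Liu's «`A_μ` is an abelian variety over `E`», Def. 4.5 (2) l. 1944), `iμ` (the rational CM structure
`i_μ : M_μ → End_E(A_μ)_ℚ` READ ON THE COMPLEX PIN, l. 1947; like `η` it may use `IsGalois ℚ F`), `δ` (an `E`-valued invariant of `End_E(A_μ)`; intended: the
determinant on `Lie_E(A_μ)`, equivalently on the cotangent space `T_e^*(A_μ)`), `η` (intended: `η_μ = η'_μ ∘ Nm_{M_μ/M'_μ}`,
Def. 4.5 (1) l. 1939–1942; it may use `IsGalois ℚ F`, under which the reflex objects are presented inside `F`).  Binders, each guarded `IsGalois ℚ F → 6 ≤ [F:ℚ] → ι₁ ∈ Φ`: `hdim` («CM structure»: `[M_μ:ℚ] =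
2 dim A_μ`, l. 1947), `hrat` (Def. 4.5 (2) first bullet on `δ`, cleared of denominators), `hη` (`ι₁ ∘ η_μ =` type norm of
`Ψ̃_μ = inducedCMType e_μ (reflexCMType ι₁ Φ_μ id)` for THE inclusion `e_μ`), `hL2` (`δ` computes `det` on `H^{1,0}` of the
pin).  Proof: §1 at `ι := ι₁`, face by face.  HC_CM is NOT proved; no binder is inhabited here.
[cite: Liu2021, Def. 4.5 (1)–(2) (FJcycle.tex l. 1939–1951), Def. 4.3 (2) (l. 1919) and §4.1 l. 1928]
[cite: Shimura1998, §5.2 (pp. 36–37) and §7.1 Prop. 7 (p. 47)] -/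
theorem hCMisogE_of_det
    (D : ∀ (F : CMField) (ι₁ : F →+* ℂ) (_ : HermSpace3 F ι₁) (_ : CMType F), Thm418Data (maximalRealSubfield F) F)
    (Aμ₀ : ∀ (F : CMField) (ι₁ : F →+* ℂ) (V : HermSpace3 F ι₁) (Φ : CMType F), (D F ι₁ V Φ).Obj → AbelianVariety F)
    (iμ : ∀ (F : CMField) [IsGalois ℚ F] (ι₁ : F →+* ℂ) (V : HermSpace3 F ι₁) (Φ : CMType F) (Dμ : (D F ι₁ V Φ).Obj),
      muAlgValueField F (D F ι₁ V Φ).μ →+* (letI := ι₁.toAlgebra; (Aμ₀ F ι₁ V Φ Dμ).baseChange ℂ).endAlgebra)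
    (δ : ∀ (F : CMField) (ι₁ : F →+* ℂ) (V : HermSpace3 F ι₁) (Φ : CMType F) (Dμ : (D F ι₁ V Φ).Obj),
      End (Aμ₀ F ι₁ V Φ Dμ) → F)
    (η : ∀ (F : CMField) [IsGalois ℚ F] (ι₁ : F →+* ℂ) (V : HermSpace3 F ι₁) (Φ : CMType F),
      muAlgValueField F (D F ι₁ V Φ).μ → F)
    (hdim : ∀ (F : CMField) [IsGalois ℚ F], 6 ≤ Module.finrank ℚ F → ∀ (Φ : CMType F) (ι₁ : F →+* ℂ), ι₁ ∈ Φ.1 →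
      ∀ (V : HermSpace3 F ι₁) (Dμ : (D F ι₁ V Φ).Obj),
        Module.finrank ℚ (muAlgValueField F (D F ι₁ V Φ).μ) = 2 * (Aμ₀ F ι₁ V Φ Dμ).dim)
    (hrat : ∀ (F : CMField) [IsGalois ℚ F], 6 ≤ Module.finrank ℚ F → ∀ (Φ : CMType F) (ι₁ : F →+* ℂ), ι₁ ∈ Φ.1 →
      ∀ (V : HermSpace3 F ι₁) (Dμ : (D F ι₁ V Φ).Obj) (k : muAlgValueField F (D F ι₁ V Φ).μ), k ≠ 0 →
        ∃ (n : ℕ) (f : End (Aμ₀ F ι₁ V Φ Dμ)), n ≠ 0 ∧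
          iμ F ι₁ V Φ Dμ k =
            algebraMap ℚ (letI := ι₁.toAlgebra; (Aμ₀ F ι₁ V Φ Dμ).baseChange ℂ).endAlgebra ((n : ℚ)⁻¹) *
              AbelianVariety.endAlgebra.of (letI := ι₁.toAlgebra; (Aμ₀ F ι₁ V Φ Dμ).baseChange ℂ)
                (letI := ι₁.toAlgebra; AbelianVariety.Hom.baseChange ℂ f) ∧
          δ F ι₁ V Φ Dμ f = (n : F) ^ (Aμ₀ F ι₁ V Φ Dμ).dim * η F ι₁ V Φ k)
    (hη : ∀ (F : CMField) [IsGalois ℚ F], 6 ≤ Module.finrank ℚ F → ∀ (Φ : CMType F) (ι₁ : F →+* ℂ), ι₁ ∈ Φ.1 →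
      ∀ (V : HermSpace3 F ι₁),
        ∀ e : reflexField ℚ F (algValuedIn ι₁ (D F ι₁ V Φ).cmType.1) →+* muAlgValueField F (D F ι₁ V Φ).μ,
          (∀ k : reflexField ℚ F (algValuedIn ι₁ (D F ι₁ V Φ).cmType.1),
            ((e k : muAlgValueField F (D F ι₁ V Φ).μ) : ℂ) = ι₁ k) →
          ∀ k : muAlgValueField F (D F ι₁ V Φ).μ, k ≠ 0 →
            ι₁ (η F ι₁ V Φ k) =
              ∏ᶠ θ ∈ (inducedCMType e (reflexCMType ι₁ (D F ι₁ V Φ).cmType (AlgHom.id ℚ F))).1, θ k)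
    (hL2 : ∀ (F : CMField) [IsGalois ℚ F], 6 ≤ Module.finrank ℚ F → ∀ (Φ : CMType F) (ι₁ : F →+* ℂ), ι₁ ∈ Φ.1 →
      ∀ (V : HermSpace3 F ι₁) (Dμ : (D F ι₁ V Φ).Obj) (f : End (Aμ₀ F ι₁ V Φ Dμ)),
        letI := ι₁.toAlgebra
        LinearMap.det ((complexBetti.map (AbelianVariety.Hom.baseChange ℂ f).hom.hom.hom 1).hom.restrict
          (fun _ hv => map_mem_hodgeOneZero
            (AbelianVariety.isSmoothProjective_holds (A := (Aμ₀ F ι₁ V Φ Dμ).baseChange ℂ))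
            (AbelianVariety.Hom.baseChange ℂ f).hom.hom.hom hv)) = ι₁ (δ F ι₁ V Φ Dμ f)) :
    ∀ (F : CMField) [IsGalois ℚ F], 6 ≤ Module.finrank ℚ F → ∀ (Φ : CMType F) (ι₁ : F →+* ℂ), ι₁ ∈ Φ.1 →
      ∀ (V : HermSpace3 F ι₁) (Dμ : (D F ι₁ V Φ).Obj),
        haveI := (D F ι₁ V Φ).isConjugateSymplectic.numberField_muAlgValueField
        ∀ e : reflexField ℚ F (algValuedIn ι₁ (D F ι₁ V Φ).cmType.1) →+* muAlgValueField F (D F ι₁ V Φ).μ,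
          (∀ k : reflexField ℚ F (algValuedIn ι₁ (D F ι₁ V Φ).cmType.1),
            ((e k : muAlgValueField F (D F ι₁ V Φ).μ) : ℂ) = ι₁ k) →
          ∃ (B : AbelianVariety ℂ) (g : (letI := ι₁.toAlgebra; (Aμ₀ F ι₁ V Φ Dμ).baseChange ℂ) ⟶ B),
            AbelianVariety.IsIsogeny g ∧
            ∃ (ιB : 𝓞 (muAlgValueField F (D F ι₁ V Φ).μ) →+* End B)
              (θB : muAlgValueField F (D F ι₁ V Φ).μ →+* Module.End ℂ (complexBetti B.X 1)),
              IsCMTypeRealisation (inducedCMType e (reflexCMType ι₁ (D F ι₁ V Φ).cmType (AlgHom.id ℚ F))) B ιB θB := by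
  intro F _ h6 Φ ι₁ hι V Dμ e he
  letI := ι₁.toAlgebra
  haveI := (D F ι₁ V Φ).isConjugateSymplectic.numberField_muAlgValueField
  exact exists_isogeny_isCMTypeRealisation_baseChange_of_detInvariant (Aμ₀ F ι₁ V Φ Dμ) (iμ F ι₁ V Φ Dμ)
    (hdim F h6 Φ ι₁ hι V Dμ) _ (δ F ι₁ V Φ Dμ) (η F ι₁ V Φ) (hrat F h6 Φ ι₁ hι V Dμ)
    (hη F h6 Φ ι₁ hι V e he) (hL2 F h6 Φ ι₁ hι V Dμ)

end Family

end Summit.HodgeConjecture.CorCM.Model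

end
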